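import Mathlib.Data.Set.Card
import Literature.MathematicalPhysics.StatisticalMechanics.BarlowStackingEnergy
import Literature.MathematicalPhysics.StatisticalMechanics.BarlowCoordination
import HarnessLib

/-!
# Barrier: pair potentials of range `< √(8/3)` are blind to the stacking (fcc / hcp / any Barlow)

Topic: `Literature/Barriers/AtomisticToContinuum` (barrier catalogue of
`AtomisticToContinuum/Crystallization`, D-0021). This file records the *energetic* form of the
stacking degeneracy of close-packed structures printed by Flatley–Theil 2015, §1: "To
differentiate between the fcc and the hcp lattice it is unavoidable to consider medium-range
interactions whose range reaches beyond nearest neighbors. Specifically, we require an analysis of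
second and third nearest neighbor interactions", and "The degeneracy of purely local models
regarding the crystalline structure is broken by the presence of long range interactions".

## Contents

* `ShortRangeStackingBlindness` (the barrier, **proved**: `ShortRangeStackingBlindness_holds`):
  for a pair potential `V` vanishing on `[2h, ∞)` and every Hägg sequence `s`, the energy of a
  site of the Barlow stacking `barlowStacking a h s` (`barlowSiteEnergy V a h s m` of
  `BarlowStackingEnergy.lean`: `½ ∑_{y ≠ x} V |x - y|`, organised layer by layer) does not depend
  on `s` nor on the layer `m`: it equals the stacking-independent constant
  `barlowBaseEnergy V a h`. For the ideal close packing `a = 1`, `h = √(2/3)` the cut-off `2h`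
  is `√(8/3)`, the third-neighbour distance of hcp (`ShortRangeStackingBlindness.ideal`). The
  proof is the tree's layer decomposition `barlowSiteEnergy_eq` plus the observation that layers
  at distance `≥ 2` are out of range, so every interlayer coupling `J_k`, `k ≥ 2`, vanishes.
* The printed shell data locating the first fcc/hcp difference at the third shell, as named
  facts: `ConwaySloane1999_fccShells` (Θ_fcc: 12, 6, 24, 12 points at distances 1, √2, √3, 2)
  and `ConwaySloane1999_hcpShells` (12, 6, 2, 18, 12, 6 points at 1, √2, √(8/3), √3, √(11/3), 2),
  Conway–Sloane Ch. 4 §6.3 (66)/Table 4.5 and §6.5 (73)/Table 4.6, rescaled to nearest-neighbour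
  distance `1`; Flatley–Theil 2015, §2.1 prints the differences
  `#{|k| = √(8/3)}: fcc − hcp = −2`, `#{|k| = √3}: fcc − hcp = 6`. The first entry (twelve points
  at distance `1`, for every Barlow stacking) is a theorem of the tree
  (`BarlowCoordination.lean`), restated on spheres as `ncard_inter_sphere_one_barlow`.
* (audit 2026-08-15) `ncard_straightBonds`, `fcc_straightBonds`, `hcp_straightBonds` (a
  nearest-neighbour three-point count is `12` on `c`-layers, `6` on `h`-layers);
  `barlowSiteEnergy₃` and `barlowSiteEnergy₃_eq` (diameter-localised three-body terms are
  stacking-blind); the narrowed barrier `ShortRangeStackingBlindnessNarrow` (proved,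
  `ShortRangeStackingBlindnessNarrow_holds`) with the corrected BARRIER block.

## Design choices

* The site energy is the one of `BarlowStackingEnergy.lean` (a `tsum` layer by layer); for a
  finitely supported bounded `V` all sums involved are finitely supported, so no junk value
  enters, but the theorem needs no such hypothesis: out-of-range layers contribute the `tsum` of
  the zero family.
* Shell counts are stated with `Set.ncard` on `S ∩ Metric.sphere x r` (Mathlib's sphere
  `{y | dist y x = r}`) for the concrete point sets `S = fccStacking 1 √(2/3)`, `hcpStacking 1 √(2/3)`
  of `BarlowStacking.lean` (Conway–Sloane, Ch. 1 §1.3: the layer sequences `…abcabc…` and `…abab…`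
  produce fcc and hcp). Search note: no shell/theta-series counts for these point sets in Mathlib or
  `Literature/` (`lean search 'sphere.*ncard'`, `'thetaSeries'`, `'coordinationNumber'`); the tree's
  `Literature.Geometry.DiscreteGeometry.kissingShell` (`FejesTothKissingTwelve.lean`) is the radius-`2` shell in Hales's
  normalisation and is not duplicated here.

## Audit 2026-08-15 (D-0021 barrier audit): NARROWED (technique class), fact CONFIRMED

The proved statement stands (axioms `propext`, `Classical.choice`, `Quot.sound`) and the quotations
were re-read at the cited places (Flatley–Theil arXiv p. 3–4 §1, p. 7 Definition 2.1 and §2.1,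
p. 9 Proposition 3.1/Theorem 3.5). What is wider than the proof is the BARRIER block: the
`technique_class:` tag `finite-range-potential` and the `blocks:` clause ("any comparison, local
energy inequality or truncation that sees the interaction only below … `√(8/3)`") quantify over
interactions in general, while the argument (here and in the source) is about PAIR potentials:
Flatley–Theil's "unavoidable … second and third nearest neighbor interactions" is printed for their
class `(V, Ψ)` whose three-body part `Ψ(r₁, r₂, r₃)` is a function of the three pairwise distances
with "`Ψ = 0` if `maxᵢ rᵢ ≥ 7/5`" — a DIAMETER cut-off below `√(8/3)`. The audit proves the exact
dividing line and files it as `ShortRangeStackingBlindnessNarrow` (end of this file):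

* BLIND (proved): pair potentials vanishing on `[2h, ∞)` (the catalogued statement) AND three-body
  potentials vanishing on every triple of diameter `≥ 2h` (`barlowSiteEnergy₃_eq`; contains
  Flatley–Theil's `Ψ`): a site of layer `m` then interacts only inside the slabs `{m, m+1}`,
  `{m−1, m}`, which are congruent for all stackings (horizontal point reflection through the site,
  `threeBodyTerm_pairFlip`).
* NOT BLIND (proved): a STAR-localised three-point term with two legs of nearest-neighbour length
  and free opening — the number of nearest neighbours `w` of `x` whose antipode `2x − w` is a site
  (straight bonds through `x`; the site energy of `W(x; y, z) = 𝟙[|y−x| = a]𝟙[y + z = 2x]`) is `12`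
  on a `c`-layer and `6` on an `h`-layer (`ncard_straightBonds`), `12` at every fcc site and `6` at
  every hcp site (`fcc_straightBonds`, `hcp_straightBonds`): the Jagodzinski/Hägg letter of a layer
  is a first-shell bond-angle observable, as are the centrosymmetry parameter, `Q₄`
  (`0.191` vs `0.097`), common-neighbour and bond-angle signatures of the structure-identification
  literature (Stukowski 2012, §2.3–§2.6), and Flatley–Theil's own Proposition 3.1 (4) ("48 pairs
  … `|z₁ − z₂| = √3` and `|z_i − z| = 1`" selects the cuboctahedron).
* Outside the statement's scope (`T = 0` energies): for hard spheres "all configurations are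
  degenerate in energy" but fcc has the highest entropy of all stackings, `0.00115(4) k_B` per
  sphere above hcp, the leading term being a field on the local three-layer pattern (Mau–Huse
  1999) — a contact-range model whose degeneracy is lifted without long-range interactions.

For the summit's conjunct (Lennard-Jones, a pair potential) the obstruction to truncating below
`√(8/3)` is unchanged; what the narrowing opens is the admissible SHAPE of local energies in a
localisation argument (star-localised `e_loc(x)` can carry the stacking selection; diameter-
localised ones provably cannot) and the finite-range `(V₂, V₃)` selection problem in `d = 3`.
The original block keeps its statement and gains `scope_caveats:`.

## References (read at the cited places)

* L. Flatley, F. Theil, *Face-centered cubic crystallization of atomistic configurations*,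
  ARMA 218 (2015) (arXiv:1407.0692): §1 (pp. 3–4), Definition 2.1 and §2.1 (p. 7).
* J. H. Conway, N. J. A. Sloane, *Sphere Packings, Lattices and Groups*, 3rd ed. (1999): Ch. 1
  §1.3; Ch. 4 §6.3 eq. (66), Table 4.5; §6.5 eq. (73), Table 4.6.
* X. Blanc, M. Lewin, *The crystallization conjecture: a review* (2015), §2.3.
* L. Bétermin, L. Šamaj, I. Travěnec, *Three-dimensional lattice ground states for Riesz and
  Lennard-Jones type energies*, Stud. Appl. Math. 150 (2022) (arXiv:2107.14020), §1.1, §3.1.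
* (audit) L. Flatley, F. Theil, loc. cit.: §2 (potrep), Definition 2.1 item 2 (p. 7), §3.1.1,
  Proposition 3.1 and Theorem 3.5 (pp. 9–10), §6 `e₃(x)` (p. 17).
* (audit) A. Stukowski, *Structure identification methods for atomistic simulations of crystalline
  materials*, Modelling Simul. Mater. Sci. Eng. 20 (2012) 045021 (arXiv:1202.5005): §2.3
  (centrosymmetry parameter, p. 4–5), §2.4 (`Q₄`, `Q₆` values, p. 5), §2.5 (CNA cut-off, p. 5),
  §2.6 (bond-angle analysis, p. 6), §2.7 (Voronoi `(0,12,0,0)` for fcc and hcp, p. 6).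
* (audit) S.-C. Mau, D. A. Huse, *Stacking entropy of hard-sphere crystals*, Phys. Rev. E 59 (1999)
  4396 (arXiv:cond-mat/9810287): Abstract; §II (`σ_i`, expansion of `S`, `(h, J) ≅ (55, 6)·10⁻⁵ k_B`).
* (audit) C. H. Loach, G. J. Ackland, Phys. Rev. Lett. 119 (2017) 205701 (arXiv:1708.01460), p. 1
  (`h`/`f` letters of layers).
* (audit) M. Friedrich, L. Kreutz, *A proof of finite crystallization via stratification*, J. Stat.
  Phys. 190 (2023) (arXiv:2209.14880), §1 (state of the art in `d = 2` with three-body angular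
  terms and in `d = 3`).
-/

noncomputable section

open Finset

namespace Literature.Barriers.AtomisticToContinuum

/-! ## Out-of-range layers do not interact -/

section ShortRange

variable {V : ℝ → ℝ} {a h : ℝ}

/-- A point of a layer at signed layer distance `k` is at distance `≥ |k| h`. [folklore] -/
theorem abs_mul_le_norm_layerVec (hh : 0 ≤ h) (δ k i j : ℤ) :
    |(k : ℝ)| * h ≤ ‖Literature.MathematicalPhysics.StatisticalMechanics.layerVec a h δ k i j‖ := by
  rw [Literature.MathematicalPhysics.StatisticalMechanics.norm_layerVec]
  calc |(k : ℝ)| * h = √(((k : ℝ) * h) ^ 2) := by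
        rw [Real.sqrt_sq_eq_abs, abs_mul, abs_of_nonneg hh]
    _ ≤ _ := by
        apply Real.sqrt_le_sqrt
        nlinarith [sq_nonneg (a * (i + j / 2 + δ / 2)), sq_nonneg (a * √3 / 2 * (j + δ / 3))]

/-- If `V` vanishes on `[2h, ∞)`, a particle does not interact with layers at distance `≥ 2`.
[folklore] -/
theorem layerInteraction_eq_zero_of_two_le (hh : 0 ≤ h) (hV : ∀ r, 2 * h ≤ r → V r = 0)
    (δ k : ℤ) (hk : 2 ≤ |k|) : Literature.MathematicalPhysics.StatisticalMechanics.layerInteraction V a h δ k = 0 := by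
  unfold Literature.MathematicalPhysics.StatisticalMechanics.layerInteraction
  refine (tsum_congr fun ij => ?_).trans tsum_zero
  apply hV
  have hk' : (2 : ℝ) ≤ |(k : ℝ)| := by rw [← Int.cast_abs]; exact_mod_cast hk
  calc 2 * h ≤ |(k : ℝ)| * h := mul_le_mul_of_nonneg_right hk' hh
    _ ≤ _ := abs_mul_le_norm_layerVec hh δ k ij.1 ij.2

/-- Hence all interlayer couplings `J_k`, `k ≥ 2`, vanish. [folklore] -/
theorem barlowCoupling_eq_zero_of_two_le (hh : 0 ≤ h) (hV : ∀ r, 2 * h ≤ r → V r = 0)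
    {k : ℕ} (hk : 2 ≤ k) : Literature.MathematicalPhysics.StatisticalMechanics.barlowCoupling V a h k = 0 := by
  have hk' : (2 : ℤ) ≤ |((k : ℕ) : ℤ)| := by rw [Int.abs_natCast]; exact_mod_cast hk
  unfold Literature.MathematicalPhysics.StatisticalMechanics.barlowCoupling
  rw [layerInteraction_eq_zero_of_two_le hh hV 0 k hk',
    layerInteraction_eq_zero_of_two_le hh hV 1 k hk', sub_zero]

/-- The layer interactions are finitely supported in the layer distance, hence summable.
[folklore] -/
theorem summable_layerInteraction_of_shortRange (hh : 0 ≤ h) (hV : ∀ r, 2 * h ≤ r → V r = 0)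
    (δ : ℤ) : Summable fun k : ℕ => Literature.MathematicalPhysics.StatisticalMechanics.layerInteraction V a h δ k := by
  refine summable_of_ne_finset_zero (s := range 2) fun k hk => ?_
  have hk2 : 2 ≤ k := by simp only [mem_range, not_lt] at hk; exact hk
  exact layerInteraction_eq_zero_of_two_le hh hV δ k
    (by rw [Int.abs_natCast]; exact_mod_cast hk2)

/-- With vanishing couplings beyond the adjacent layer, the forward local stacking energy is `0`.
[folklore] -/
theorem haggLocalEnergy_eq_zero_of_couplings {J : ℕ → ℝ} (hJ : ∀ k, 2 ≤ k → J k = 0)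
    (s : ℤ → ℤ) (m : ℤ) : Literature.MathematicalPhysics.StatisticalMechanics.haggLocalEnergy J s m = 0 := by
  unfold Literature.MathematicalPhysics.StatisticalMechanics.haggLocalEnergy
  refine (tsum_congr fun k => ?_).trans tsum_zero
  split_ifs with hk
  · exact hJ k hk.1
  · rfl

/-- … and so is the backward one. [folklore] -/
theorem haggBackwardLocalEnergy_eq_zero_of_couplings {J : ℕ → ℝ} (hJ : ∀ k, 2 ≤ k → J k = 0)
    (s : ℤ → ℤ) (m : ℤ) : Literature.MathematicalPhysics.StatisticalMechanics.haggBackwardLocalEnergy J s m = 0 := by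
  unfold Literature.MathematicalPhysics.StatisticalMechanics.haggBackwardLocalEnergy
  refine (tsum_congr fun k => ?_).trans tsum_zero
  split_ifs with hk
  · exact hJ k hk.1
  · rfl

end ShortRange

/-! ## The barrier -/

/-- **Barrier `ShortRangeStackingBlindness`: a pair potential that does not reach the second
layer cannot tell stackings apart.** For every pair potential `V : ℝ → ℝ` vanishing on
`[2h, ∞)` (`0 ≤ h`), every in-layer spacing `a`, every Hägg sequence `s` (every stacking
`…ABC…`, `…ABAB…`, or any other walk on `{A, B, C}`) and every layer `m`, the energy of a site
of layer `m` of `barlowStacking a h s` equals the stacking-independent constant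
`barlowBaseEnergy V a h = ½ Φ₀ + ∑_{k ≥ 1} Φ_N(k)`; in particular fcc, hcp and every non-periodic
Barlow stacking have the same energy per particle for such `V`. For the ideal close packing
(`a = 1`, `h = √(2/3)`) the threshold `2h = √(8/3)` is the third-neighbour distance of hcp
(`ShortRangeStackingBlindness.ideal`). This is the energetic form of "the degeneracy of purely
local models regarding the crystalline structure" (Flatley–Theil 2015, §1). Proved below
(`ShortRangeStackingBlindness_holds`).

BARRIER (D-0021; every clause is a citation, not an assessment)
* technique_class: finite-range-potential nearest-neighbour-localisation sphere-packing-reduction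
* blocks: identifying the periodic minimiser `P` of `Literature.StatMech.HasPeriodicGroundStateEnergy lennardJones 3`, or the limit configuration in `Literature.StatMech.IsCrystallizing lennardJones 3`, by any comparison, local energy inequality or truncation that sees the interaction only below the third-neighbour distance `√(8/3)` (first shell `1` and second shell `√2`): "To differentiate between the fcc and the hcp lattice it is unavoidable to consider medium-range interactions whose range reaches beyond nearest neighbors. Specifically, we require an analysis of second and third nearest neighbor interactions" [cite: FlatleyTheil2015, §1 (arXiv p. 4)]
* because: fcc and hcp have the same first and second shells (12 points at distance 1, 6 at √2) and differ first at the third (fcc: none at √(8/3), 24 at √3; hcp: 2 at √(8/3), 18 at √3) [cite: ConwaySloane1999, Ch. 4 §6.3 (66) Table 4.5 and §6.5 (73) Table 4.6] [cite: FlatleyTheil2015, §2.1 (fcc − hcp shell counts −2 at √(8/3), +6 at √3)]; more generally a particle of any Barlow stacking interacts identically with its own and the two adjacent layers whatever the stacking, and layers at distance ≥ 2 start at height `2h` (this file, `ShortRangeStackingBlindness_holds`); in the sticky-sphere limit the crystallization problem "is thus equivalent to the sphere packing", with fcc, hcp "and even non-periodic arrangements" as solutions [cite: BlancLewin2015, 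§2.3]
* evasions_known: (i) impose the third-shell selection as a hypothesis on `V` — Flatley–Theil's fcc condition `V(√(8/3)) − 3 V(√3) ≥ α^{1/2}` in the class of `α`-localized potentials, together with a three-body term [cite: FlatleyTheil2015, Definition 2.1 and §2.1, Theorem 1.1]; (ii) keep the long-range tail and decide the fcc/hcp competition by lattice sums beyond the second shell — among three-dimensional lattices with hcp adjoined, Lennard-Jones-type `(n, m)` energies are minimised by fcc or hcp depending on the exponents (numerically; hcp "expected" for `(12, 6)`) [cite: BeterminSamajTravenec2022, §1.1 (p. 2) and §3.1 (p. 8)]; no evasion is published for the positional statement with a pure pair potential ("completely open in dimension three") [cite: BlancLewin2015, §2.3]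
* scope_caveats: (a) AUDIT 2026-08-15 (D-0021 barrier audit; NARROWED, see `ShortRangeStackingBlindnessNarrow` at the end of this file): the statement and its proof quantify over PAIR potentials `V : ℝ → ℝ` (site energy `½ ∑ V(|x − y|)`); of the tag `finite-range-potential` and of the `blocks:` clause ("any comparison, local energy inequality or truncation that sees the interaction only below … `√(8/3)`") only distance-only and DIAMETER-localised local energies are covered — three-body potentials `Ψ(r₁, r₂, r₃)` vanishing on triples of diameter `≥ 2h` are blind as well (`barlowSiteEnergy₃_eq`), and the quoted "unavoidable … second and third nearest neighbor interactions" is printed for exactly such a class ("`Ψ(r₁, r₂, r₃) = 0` if `maxᵢ rᵢ ≥ 7/5`") [cite: FlatleyTheil2015, Definition 2.1 (2)]; STAR-localised (bond-angle) three-point terms with nearest-neighbour legs are not blind: the straight-bond count `#{w : |w − x| = a, 2x − w ∈ S}` is `12` on `c`-layers and `6` on `h`-layers, `12` throughout fcc and `6` throughout hcp (`ncard_straightBonds`, `fcc_straightBonds`, `hcp_straightBonds`), in line with the first-shell discriminators of the structure-identification literature (centrosymmetry, `Q₄ = 0.191` vs `0.097`, common-neighbour and bond-angle analysis) [cite: Stukowski2012,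 §2.3–§2.6] and with Flatley–Theil's own selection of the cuboctahedron by "48 pairs … `|z₁ − z₂| = √3` and `|z_i − z| = 1`" [cite: FlatleyTheil2015, Proposition 3.1]; (b) zero temperature, static energies: for hard spheres "all configurations are degenerate in energy" while fcc has the highest entropy of all stackings (`0.00115 ± 0.00004 k_B` per sphere above hcp at close packing), the leading term being a field on the local three-layer pattern [cite: MauHuse1999, Abstract and §II]; (c) perfect Barlow stackings only (no defects, surfaces or non-close-packed competitors); for the summit's Lennard-Jones PAIR energy the obstruction to truncation below `√(8/3)` is unchanged
* status: theorem (proved in this file for all Barlow stackings; shell data classical)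

[cite: FlatleyTheil2015, §1 (arXiv p. 4) and §2.1] [cite: ConwaySloane1999, Ch. 4 §6.3, §6.5] -/
def ShortRangeStackingBlindness : Prop :=
  ∀ (V : ℝ → ℝ) (a h : ℝ), 0 ≤ h → (∀ r, 2 * h ≤ r → V r = 0) →
    ∀ s : ℤ → ℤ, Literature.MathematicalPhysics.StatisticalMechanics.IsHaggSeq s → ∀ m : ℤ, Literature.MathematicalPhysics.StatisticalMechanics.barlowSiteEnergy V a h s m = Literature.MathematicalPhysics.StatisticalMechanics.barlowBaseEnergy V a h

/-- **Proof of the barrier fact** from the layer decomposition `barlowSiteEnergy_eq` of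
`BarlowStackingEnergy.lean`: the couplings `J_k = Φ_A(k) − Φ_N(k)` vanish for `k ≥ 2` because
every point of a layer at distance `k` is at distance `≥ k h ≥ 2h`, where `V = 0`. [folklore] -/
theorem ShortRangeStackingBlindness_holds : ShortRangeStackingBlindness := by
  intro V a h hh hV s hs m
  have hJ : ∀ k, 2 ≤ k → Literature.MathematicalPhysics.StatisticalMechanics.barlowCoupling V a h k = 0 := fun k hk =>
    barlowCoupling_eq_zero_of_two_le hh hV hk
  rw [Literature.MathematicalPhysics.StatisticalMechanics.barlowSiteEnergy_eq V a h hs (summable_layerInteraction_of_shortRange hh hV 0)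
    (summable_layerInteraction_of_shortRange hh hV 1) m,
    haggLocalEnergy_eq_zero_of_couplings hJ, haggBackwardLocalEnergy_eq_zero_of_couplings hJ]
  ring

/-- **The ideal close packing.** For nearest-neighbour distance `1` and layer spacing `√(2/3)`
(touching balls, `dist_barlowPos_succ_eq`), a pair potential vanishing on `[√(8/3), ∞)` — i.e.
seeing at most the first shell (distance `1`) and the second shell (`√2`) — gives every site of
every Barlow stacking (fcc `…ABC…`, hcp `…ABAB…`, or non-periodic) the same energy.
[cite: FlatleyTheil2015, §1 (arXiv p. 4)] -/
theorem ShortRangeStackingBlindness.ideal {V : ℝ → ℝ} (hV : ∀ r, √(8 / 3) ≤ r → V r = 0)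
    {s s' : ℤ → ℤ} (hs : Literature.MathematicalPhysics.StatisticalMechanics.IsHaggSeq s) (hs' : Literature.MathematicalPhysics.StatisticalMechanics.IsHaggSeq s') (m m' : ℤ) :
    Literature.MathematicalPhysics.StatisticalMechanics.barlowSiteEnergy V 1 (√(2 / 3)) s m = Literature.MathematicalPhysics.StatisticalMechanics.barlowSiteEnergy V 1 (√(2 / 3)) s' m' := by
  have h2 : 2 * √(2 / 3) = √(8 / 3) := by
    rw [show (8 : ℝ) / 3 = 2 ^ 2 * (2 / 3) by norm_num, Real.sqrt_mul (by norm_num),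
      Real.sqrt_sq (by norm_num : (0 : ℝ) ≤ 2)]
  have hV' : ∀ r, 2 * √(2 / 3) ≤ r → V r = 0 := fun r hr => hV r (h2 ▸ hr)
  rw [ShortRangeStackingBlindness_holds V 1 _ (Real.sqrt_nonneg _) hV' s hs m,
    ShortRangeStackingBlindness_holds V 1 _ (Real.sqrt_nonneg _) hV' s' hs' m']

/-- In particular fcc and hcp sites have equal energy for such `V`. [cite: FlatleyTheil2015, §1] -/
theorem ShortRangeStackingBlindness.fcc_eq_hcp {V : ℝ → ℝ} (hV : ∀ r, √(8 / 3) ≤ r → V r = 0)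
    (m m' : ℤ) :
    Literature.MathematicalPhysics.StatisticalMechanics.barlowSiteEnergy V 1 (√(2 / 3)) Literature.MathematicalPhysics.StatisticalMechanics.constHagg m = Literature.MathematicalPhysics.StatisticalMechanics.barlowSiteEnergy V 1 (√(2 / 3)) Literature.MathematicalPhysics.StatisticalMechanics.alternatingHagg m' :=
  ShortRangeStackingBlindness.ideal hV Literature.MathematicalPhysics.StatisticalMechanics.isHaggSeq_const Literature.MathematicalPhysics.StatisticalMechanics.isHaggSeq_alternating m m'

/-! ## Where the first difference is: the printed shell counts -/

/-- **First shell, every stacking (proved).** Around every point of every ideal Barlow stacking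
`barlowStacking 1 √(2/3) s` (`s` a Hägg sequence) there are exactly twelve points at distance `1`
— the tree's `ncard_touching_eq_twelve` (`BarlowCoordination.lean`; Hales, *Dense Sphere
Packings* §1.3; Conway–Sloane: coordination number `S(1) = 12` of every Barlow packing) restated on
`Metric.sphere`. [cite: ConwaySloane1999, Preface 3rd ed., Notes on Ch. 4; Ch. 4 §6.3, §6.5] -/
theorem ncard_inter_sphere_one_barlow {s : ℤ → ℤ} (hs : Literature.MathematicalPhysics.StatisticalMechanics.IsHaggSeq s)
    {x : EuclideanSpace ℝ (Fin 3)} (hx : x ∈ Literature.MathematicalPhysics.StatisticalMechanics.barlowStacking 1 (√(2 / 3)) s) :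
    (Literature.MathematicalPhysics.StatisticalMechanics.barlowStacking 1 (√(2 / 3)) s ∩ Metric.sphere x 1).ncard = 12 := by
  have hset : Literature.MathematicalPhysics.StatisticalMechanics.barlowStacking 1 (√(2 / 3)) s ∩ Metric.sphere x 1 =
      {w | w ∈ Literature.MathematicalPhysics.StatisticalMechanics.barlowStacking 1 (√(2 / 3)) s ∧ dist x w = 1} := by
    ext w
    simp only [Set.mem_inter_iff, Metric.mem_sphere, Set.mem_setOf_eq, dist_comm]
  rw [hset]
  exact Literature.MathematicalPhysics.StatisticalMechanics.ncard_touching_eq_twelve hs one_pos (by rw [Real.sq_sqrt (by norm_num)]; norm_num) hx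

/-- **The first shells of fcc** (Conway–Sloane, Ch. 4 §6.3: `Θ_fcc = 1 + 12q² + 6q⁴ + 24q⁶ + ⋯`,
Table 4.5: `N(8) = 12`, no odd norms, for `D₃` with minimal norm `2`; rescaled by `1/√2` to
nearest-neighbour distance `1`, and Ch. 1 §1.3: the layer sequence `…abcabc…` produces fcc):
around every point of `fccStacking 1 √(2/3)` there are exactly `12, 6, 24, 12` points at
distances `1, √2, √3, 2`, and no other distance `≤ 2` occurs.
[cite: ConwaySloane1999, Ch. 4 §6.3 (66) and Table 4.5; Ch. 1 §1.3] -/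
def ConwaySloane1999_fccShells : Prop :=
  ∀ x ∈ Literature.MathematicalPhysics.StatisticalMechanics.fccStacking 1 (√(2 / 3)),
    (Literature.MathematicalPhysics.StatisticalMechanics.fccStacking 1 (√(2 / 3)) ∩ Metric.sphere x 1).ncard = 12 ∧
    (Literature.MathematicalPhysics.StatisticalMechanics.fccStacking 1 (√(2 / 3)) ∩ Metric.sphere x (√2)).ncard = 6 ∧
    (Literature.MathematicalPhysics.StatisticalMechanics.fccStacking 1 (√(2 / 3)) ∩ Metric.sphere x (√3)).ncard = 24 ∧
    (Literature.MathematicalPhysics.StatisticalMechanics.fccStacking 1 (√(2 / 3)) ∩ Metric.sphere x 2).ncard = 12 ∧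
    ∀ y ∈ Literature.MathematicalPhysics.StatisticalMechanics.fccStacking 1 (√(2 / 3)), dist x y ≤ 2 →
      dist x y ∈ ({0, 1, √2, √3, 2} : Set ℝ)

/-- **The first shells of hcp** (Conway–Sloane, Ch. 4 §6.5: with minimal norm `1`,
`Θ_hcp = 1 + 12q + 6q² + 2q^{8/3} + ⋯`, Table 4.6: `N(3) = 18`, `N(11/3) = 12`, `N(4) = 6` and
`N(m) = 0` for the other `m ≤ 4`; Ch. 1 §1.3: the layer sequence `…abab…` produces hcp):
around every point of `hcpStacking 1 √(2/3)` there are exactly `12, 6, 2, 18, 12, 6` points at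
distances `1, √2, √(8/3), √3, √(11/3), 2`, and no other distance `≤ 2` occurs. (Flatley–Theil
2015, §2.1: `#{|k| = √(8/3)}`: fcc − hcp `= −2`; `#{|k| = √3}`: fcc − hcp `= 6`.)
[cite: ConwaySloane1999, Ch. 4 §6.5 (73) and Table 4.6; Ch. 1 §1.3]
[cite: FlatleyTheil2015, §2.1] -/
def ConwaySloane1999_hcpShells : Prop :=
  ∀ x ∈ Literature.MathematicalPhysics.StatisticalMechanics.hcpStacking 1 (√(2 / 3)),
    (Literature.MathematicalPhysics.StatisticalMechanics.hcpStacking 1 (√(2 / 3)) ∩ Metric.sphere x 1).ncard = 12 ∧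
    (Literature.MathematicalPhysics.StatisticalMechanics.hcpStacking 1 (√(2 / 3)) ∩ Metric.sphere x (√2)).ncard = 6 ∧
    (Literature.MathematicalPhysics.StatisticalMechanics.hcpStacking 1 (√(2 / 3)) ∩ Metric.sphere x (√(8 / 3))).ncard = 2 ∧
    (Literature.MathematicalPhysics.StatisticalMechanics.hcpStacking 1 (√(2 / 3)) ∩ Metric.sphere x (√3)).ncard = 18 ∧
    (Literature.MathematicalPhysics.StatisticalMechanics.hcpStacking 1 (√(2 / 3)) ∩ Metric.sphere x (√(11 / 3))).ncard = 12 ∧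
    (Literature.MathematicalPhysics.StatisticalMechanics.hcpStacking 1 (√(2 / 3)) ∩ Metric.sphere x 2).ncard = 6 ∧
    ∀ y ∈ Literature.MathematicalPhysics.StatisticalMechanics.hcpStacking 1 (√(2 / 3)), dist x y ≤ 2 →
      dist x y ∈ ({0, 1, √2, √(8 / 3), √3, √(11 / 3), 2} : Set ℝ)

/-- The first two shells of fcc and hcp coincide (`12` at `1`, `6` at `√2`): the shell counts
below `√(8/3)` agree. [cite: ConwaySloane1999, Ch. 4 §6.3, §6.5] -/
theorem fcc_hcp_first_two_shells (h₁ : ConwaySloane1999_fccShells) (h₂ : ConwaySloane1999_hcpShells)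
    {x x' : EuclideanSpace ℝ (Fin 3)} (hx : x ∈ Literature.MathematicalPhysics.StatisticalMechanics.fccStacking 1 (√(2 / 3)))
    (hx' : x' ∈ Literature.MathematicalPhysics.StatisticalMechanics.hcpStacking 1 (√(2 / 3))) :
    (Literature.MathematicalPhysics.StatisticalMechanics.fccStacking 1 (√(2 / 3)) ∩ Metric.sphere x 1).ncard =
        (Literature.MathematicalPhysics.StatisticalMechanics.hcpStacking 1 (√(2 / 3)) ∩ Metric.sphere x' 1).ncard ∧
      (Literature.MathematicalPhysics.StatisticalMechanics.fccStacking 1 (√(2 / 3)) ∩ Metric.sphere x (√2)).ncard =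
        (Literature.MathematicalPhysics.StatisticalMechanics.hcpStacking 1 (√(2 / 3)) ∩ Metric.sphere x' (√2)).ncard := by
  obtain ⟨a1, a2, -⟩ := h₁ x hx
  obtain ⟨b1, b2, -⟩ := h₂ x' hx'
  exact ⟨a1.trans b1.symm, a2.trans b2.symm⟩

/-! ## Audit 2026-08-15: a star-localised three-point count reads the letter of the layer -/

section StraightBonds

open Literature.MathematicalPhysics.StatisticalMechanics

variable {a h : ℝ} {s : ℤ → ℤ}

/-- Point reflection inside a Barlow stacking: the antipode `2x − y` of `y = barlowPos k' i' j'`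
through `x = barlowPos k i j` is the point `(2i − i' + q, 2j − j' + q)` of layer `k''`,
`k' + k'' = 2k`, whenever the letters satisfy `L(k') + L(k'') + 3q = 2 L(k)`. [folklore] -/
theorem two_smul_barlowPos_sub (a h : ℝ) (s : ℤ → ℤ) {k k' k'' q : ℤ} (hk : k' + k'' = 2 * k)
    (i j i' j' : ℤ) (hL : haggLabel s k' + haggLabel s k'' + 3 * q = 2 * haggLabel s k) :
    (2 : ℝ) • barlowPos a h s k i j - barlowPos a h s k' i' j' =
      barlowPos a h s k'' (2 * i - i' + q) (2 * j - j' + q) := by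
  have hk' : (k'' : ℝ) = 2 * k - k' := by exact_mod_cast (by omega : k'' = 2 * k - k')
  have hL' : (haggLabel s k'' : ℝ) = 2 * haggLabel s k - haggLabel s k' - 3 * q := by
    exact_mod_cast (by omega : haggLabel s k'' = 2 * haggLabel s k - haggLabel s k' - 3 * q)
  ext l
  fin_cases l <;> simp [-mul_eq_mul_left_iff, -mul_eq_mul_right_iff, hL', hk'] <;> ring

/-- Conversely, if the antipode of `barlowPos k' i' j'` through `barlowPos k i j` is a point of
the stacking, then `3 ∣ 2 L(k) − L(k') − L(2k − k')`. [folklore] -/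
theorem three_dvd_of_two_smul_sub_mem (ha : a ≠ 0) (hh : h ≠ 0) {k k' i j i' j' : ℤ}
    (hmem : (2 : ℝ) • barlowPos a h s k i j - barlowPos a h s k' i' j' ∈ barlowStacking a h s) :
    (3 : ℤ) ∣ 2 * haggLabel s k - haggLabel s k' - haggLabel s (2 * k - k') := by
  obtain ⟨k'', i'', j'', heq⟩ := hmem
  have e2 := congrArg (fun v : EuclideanSpace ℝ (Fin 3) => v 2) heq
  simp only [PiLp.sub_apply, PiLp.smul_apply, smul_eq_mul, barlowPos_apply_two] at e2
  have hk'' : k'' = 2 * k - k' := by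
    have h0 : ((k'' : ℝ) - (2 * k - k')) * h = 0 := by linarith
    rcases mul_eq_zero.1 h0 with h0 | h0
    · exact_mod_cast (by linarith : (k'' : ℝ) = 2 * k - k')
    · exact absurd h0 hh
  subst hk''
  have e1 := congrArg (fun v : EuclideanSpace ℝ (Fin 3) => v 1) heq
  simp only [PiLp.sub_apply, PiLp.smul_apply, smul_eq_mul, barlowPos_apply_one] at e1
  have h3 : (0 : ℝ) < √3 := by positivity
  have hj : a * √3 *
      (2 * ((j : ℝ) + haggLabel s k / 3) - ((j' : ℝ) + haggLabel s k' / 3) -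
        ((j'' : ℝ) + haggLabel s (2 * k - k') / 3)) = 0 := by
    linarith
  have hj' : 2 * ((j : ℝ) + haggLabel s k / 3) - ((j' : ℝ) + haggLabel s k' / 3) -
      ((j'' : ℝ) + haggLabel s (2 * k - k') / 3) = 0 := by
    rcases mul_eq_zero.1 hj with h0 | h0
    · rcases mul_eq_zero.1 h0 with h1 | h1
      · exact absurd h1 ha
      · linarith
    · exact h0
  refine ⟨j'' - 2 * j + j', ?_⟩
  have : (2 * haggLabel s k - haggLabel s k' - haggLabel s (2 * k - k') : ℝ) =
      3 * ((j'' : ℝ) - 2 * j + j') := by linarith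
  exact_mod_cast this

/-- The letter combination across a layer: `2 L(k) − L(k+1) − L(k−1) = s(k−1) − s(k)`.
[folklore] -/
theorem two_mul_haggLabel_sub (s : ℤ → ℤ) (k : ℤ) :
    2 * haggLabel s k - haggLabel s (k + 1) - haggLabel s (k - 1) = s (k - 1) - s k := by
  have h1 := haggLabel_sub_haggLabel_succ s k
  have h2 := haggLabel_sub_haggLabel_pred s k
  linarith

/-- **`c`-layers: every bond through the site is straight-continuable.** If `s k = s (k − 1)`
(the layers `k − 1, k, k + 1` carry three different letters, a cubic `c` layer in Jagodzinski's
notation), every nearest neighbour `w` of `x = barlowPos k i j` has its antipode `2x − w` in the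
stacking. [folklore] -/
theorem straightBonds_eq_touching_of_eq (hs : IsHaggSeq s) (ha : 0 < a)
    (hh : h ^ 2 = 2 / 3 * a ^ 2) {k : ℤ} (hc : s k = s (k - 1)) (i j : ℤ) :
    {w | w ∈ barlowStacking a h s ∧ dist (barlowPos a h s k i j) w = a ∧
        (2 : ℝ) • barlowPos a h s k i j - w ∈ barlowStacking a h s} =
      {w | w ∈ barlowStacking a h s ∧ dist (barlowPos a h s k i j) w = a} := by
  ext w
  simp only [Set.mem_setOf_eq]
  constructor
  · rintro ⟨hw, hd, -⟩
    exact ⟨hw, hd⟩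
  · rintro ⟨hw, hd⟩
    refine ⟨hw, hd, ?_⟩
    obtain ⟨k', i', j', rfl⟩ := hw
    rcases (dist_barlowPos_eq_iff hs ha hh k i j k' i' j').1 hd with
      ⟨hk, -⟩ | ⟨hk, -⟩ | ⟨hk, -⟩ <;> rw [hk]
    · rw [two_smul_barlowPos_sub a h s (k'' := k) (q := 0) (by ring) i j i' j' (by ring)]
      exact barlowPos_mem _ _ _
    · rw [two_smul_barlowPos_sub a h s (k'' := k - 1) (q := 0) (by ring) i j i' j'
        (by linarith [two_mul_haggLabel_sub s k])]
      exact barlowPos_mem _ _ _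
    · rw [two_smul_barlowPos_sub a h s (k'' := k + 1) (q := 0) (by ring) i j i' j'
        (by linarith [two_mul_haggLabel_sub s k])]
      exact barlowPos_mem _ _ _

/-- **`h`-layers: only the six in-layer bonds are straight-continuable.** If `s k ≠ s (k − 1)`
(the layers `k − 1` and `k + 1` carry the same letter, a hexagonal `h` layer), the nearest
neighbours of `x = barlowPos k i j` whose antipode is in the stacking are exactly the six in-layer
ones. [folklore] -/
theorem straightBonds_eq_image_of_ne (hs : IsHaggSeq s) (ha : 0 < a)
    (hh : h ^ 2 = 2 / 3 * a ^ 2) {k : ℤ} (hc : s k ≠ s (k - 1)) (i j : ℤ) :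
    {w | w ∈ barlowStacking a h s ∧ dist (barlowPos a h s k i j) w = a ∧
        (2 : ℝ) • barlowPos a h s k i j - w ∈ barlowStacking a h s} =
      offsetPos a h s i j k '' ↑sixOffsets := by
  have hh0 : h ≠ 0 := by
    intro h0
    rw [h0] at hh
    nlinarith
  ext w
  simp only [Set.mem_setOf_eq, Set.mem_image, Finset.mem_coe]
  constructor
  · rintro ⟨hw, hd, hanti⟩
    obtain ⟨k', i', j', rfl⟩ := hw
    rcases (dist_barlowPos_eq_iff hs ha hh k i j k' i' j').1 hd with
      ⟨hk, hm⟩ | ⟨hk, -⟩ | ⟨hk, -⟩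
    · exact ⟨(i - i', j - j'), hm, by simp [offsetPos, hk]⟩
    · exfalso
      rw [hk] at hanti
      have h3 := three_dvd_of_two_smul_sub_mem ha.ne' hh0 hanti
      rw [show 2 * k - (k + 1) = k - 1 by ring, two_mul_haggLabel_sub] at h3
      rcases hs k with h1 | h1 <;> rcases hs (k - 1) with h2 | h2 <;> omega
    · exfalso
      rw [hk] at hanti
      have h3 := three_dvd_of_two_smul_sub_mem ha.ne' hh0 hanti
      rw [show 2 * k - (k - 1) = k + 1 by ring] at h3
      have h4 := two_mul_haggLabel_sub s k
      rcases hs k with h1 | h1 <;> rcases hs (k - 1) with h2 | h2 <;> omega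
  · rintro ⟨PQ, hm, rfl⟩
    refine ⟨barlowPos_mem _ _ _, (dist_barlowPos_eq_iff hs ha hh k i j _ _ _).2
      (Or.inl ⟨rfl, by simpa using hm⟩), ?_⟩
    simp only [offsetPos]
    rw [two_smul_barlowPos_sub a h s (k'' := k) (q := 0) (by ring) i j _ _ (by ring)]
    exact barlowPos_mem _ _ _

/-- **The straight-bond count reads the Jagodzinski letter of the layer.** In the ideal stacking
(`0 < a`, `h² = ⅔ a²`) of a Hägg sequence `s`, the number of nearest neighbours `w` of the site
`x = barlowPos k i j` whose antipode `2x − w` is again a site — equivalently, the site energy of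
the three-body term `W(x; y, z) = 𝟙[|y − x| = a] · 𝟙[y + z = 2x]`, whose two legs have the
nearest-neighbour length `a` — is `12` on a `c`-layer (`s k = s (k−1)`) and `6` on an `h`-layer.
[folklore] -/
theorem ncard_straightBonds (hs : IsHaggSeq s) (ha : 0 < a) (hh : h ^ 2 = 2 / 3 * a ^ 2)
    (k i j : ℤ) :
    {w | w ∈ barlowStacking a h s ∧ dist (barlowPos a h s k i j) w = a ∧
        (2 : ℝ) • barlowPos a h s k i j - w ∈ barlowStacking a h s}.ncard =
      if s k = s (k - 1) then 12 else 6 := by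
  split_ifs with hc
  · rw [straightBonds_eq_touching_of_eq hs ha hh hc]
    exact ncard_touching_barlowPos hs ha hh k i j
  · rw [straightBonds_eq_image_of_ne hs ha hh hc,
      Set.ncard_image_of_injective _ (offsetPos_injective ha i j k), Set.ncard_coe_finset,
      card_sixOffsets]


end StraightBonds

/-! ## Audit 2026-08-15: diameter-localised three-body terms are stacking-blind -/

section ThreeBody

open Literature.MathematicalPhysics.StatisticalMechanics

variable {a h : ℝ}

/-! ### Index bookkeeping -/

/-- `(k, i, j) ↦ (k, ε i, ε j)`; for `ε = -1` this is the horizontal point reflection of the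
index of a site through the central site (layer offset `k` kept). [folklore] -/
def scaleIdx (ε : ℤ) (p : ℤ × ℤ × ℤ) : ℤ × ℤ × ℤ := (p.1, ε * p.2.1, ε * p.2.2)

/-- `scaleIdx ε` is an involution for `ε = ±1`. [folklore] -/
theorem scaleIdx_scaleIdx {ε : ℤ} (hε : ε = 1 ∨ ε = -1) (p : ℤ × ℤ × ℤ) :
    scaleIdx ε (scaleIdx ε p) = p := by
  obtain ⟨k, i, j⟩ := p
  have h1 : ε * ε = 1 := by rcases hε with rfl | rfl <;> norm_num
  simp only [scaleIdx, ← mul_assoc, h1, one_mul]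

/-- Only the central index is mapped to the central index by `scaleIdx ε`, `ε = ±1`.
[folklore] -/
theorem scaleIdx_eq_zero_iff {ε : ℤ} (hε : ε = 1 ∨ ε = -1) {p : ℤ × ℤ × ℤ} :
    scaleIdx ε p = 0 ↔ p = 0 := by
  constructor
  · intro h0
    rw [← scaleIdx_scaleIdx hε p, h0]
    simp [scaleIdx]
  · rintro rfl
    simp [scaleIdx]

/-- `scaleIdx ε` is injective for `ε = ±1`. [folklore] -/
theorem scaleIdx_inj {ε : ℤ} (hε : ε = 1 ∨ ε = -1) {p q : ℤ × ℤ × ℤ} :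
    scaleIdx ε p = scaleIdx ε q ↔ p = q :=
  (Function.Involutive.injective (scaleIdx_scaleIdx hε)).eq_iff

/-- The sign applied to a pair of sites at layer offsets `k₁, k₂` from the central site: `εU` if
one of them is in the layer above, else `εD` if one is in the layer below, else `1`. [folklore] -/
def pairSign (εU εD k₁ k₂ : ℤ) : ℤ :=
  if k₁ = 1 ∨ k₂ = 1 then εU else if k₁ = -1 ∨ k₂ = -1 then εD else 1

/-- `pairSign` is symmetric in the two layer offsets. [folklore] -/
theorem pairSign_comm (εU εD k₁ k₂ : ℤ) : pairSign εU εD k₁ k₂ = pairSign εU εD k₂ k₁ := by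
  unfold pairSign
  simp only [or_comm]

/-- `pairSign` takes the values `±1`. [folklore] -/
theorem pairSign_mem {εU εD : ℤ} (hU : εU = 1 ∨ εU = -1) (hD : εD = 1 ∨ εD = -1) (k₁ k₂ : ℤ) :
    pairSign εU εD k₁ k₂ = 1 ∨ pairSign εU εD k₁ k₂ = -1 := by
  unfold pairSign
  split_ifs
  · exact hU
  · exact hD
  · exact Or.inl rfl

/-- The reindexing of ordered pairs of sites: both indices are reflected with the sign
`pairSign εU εD k₁ k₂`. [folklore] -/
def pairFlip (εU εD : ℤ) (pq : (ℤ × ℤ × ℤ) × (ℤ × ℤ × ℤ)) : (ℤ × ℤ × ℤ) × (ℤ × ℤ × ℤ) :=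
  (scaleIdx (pairSign εU εD pq.1.1 pq.2.1) pq.1, scaleIdx (pairSign εU εD pq.1.1 pq.2.1) pq.2)

/-- `pairFlip` is an involution (the sign only depends on the layer offsets, which it keeps).
[folklore] -/
theorem pairFlip_involutive {εU εD : ℤ} (hU : εU = 1 ∨ εU = -1) (hD : εD = 1 ∨ εD = -1) :
    Function.Involutive (pairFlip εU εD) := by
  rintro ⟨p, q⟩
  have hε := pairSign_mem hU hD p.1 q.1
  have h1 : (scaleIdx (pairSign εU εD p.1 q.1) p).1 = p.1 := rfl
  have h2 : (scaleIdx (pairSign εU εD p.1 q.1) q).1 = q.1 := rfl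
  simp only [pairFlip, h1, h2, scaleIdx_scaleIdx hε]

/-- `pairFlip` as a permutation of the index set. [folklore] -/
def pairFlipPerm {εU εD : ℤ} (hU : εU = 1 ∨ εU = -1) (hD : εD = 1 ∨ εD = -1) :
    Equiv.Perm ((ℤ × ℤ × ℤ) × (ℤ × ℤ × ℤ)) :=
  Function.Involutive.toPerm (pairFlip εU εD) (pairFlip_involutive hU hD)

/-! ### Geometry: reflected indices give congruent clusters -/

/-- `‖layerVec (ε δ) k (ε i) (ε j)‖ = ‖layerVec δ k i j‖` for `ε = ±1` (horizontal point
reflection). [folklore] -/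
theorem norm_layerVec_scale {ε : ℤ} (hε : ε = 1 ∨ ε = -1) (δ k i j : ℤ) :
    ‖layerVec a h (ε * δ) k (ε * i) (ε * j)‖ = ‖layerVec a h δ k i j‖ := by
  rcases hε with rfl | rfl
  · simp
  · rw [norm_layerVec, norm_layerVec]
    congr 1
    push_cast
    ring

/-- Distance from the central site of layer `n` to the site `(i, j)` of layer `n + k`.
[folklore] -/
theorem dist_site_eq_norm_layerVec (t : ℤ → ℤ) (n k i j : ℤ) :
    dist (barlowPos a h t n 0 0) (barlowPos a h t (n + k) i j) =
      ‖layerVec a h (haggLabel t (n + k) - haggLabel t n) k i j‖ := by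
  rw [dist_barlowPos_eq_norm_layerVec, add_sub_cancel_left, sub_zero, sub_zero]

/-- Distance between two sites in layers `n + k₁`, `n + k₂`. [folklore] -/
theorem dist_sites_eq_norm_layerVec (t : ℤ → ℤ) (n k₁ i₁ j₁ k₂ i₂ j₂ : ℤ) :
    dist (barlowPos a h t (n + k₁) i₁ j₁) (barlowPos a h t (n + k₂) i₂ j₂) =
      ‖layerVec a h ((haggLabel t (n + k₂) - haggLabel t n) - (haggLabel t (n + k₁) - haggLabel t n))
        (k₂ - k₁) (i₂ - i₁) (j₂ - j₁)‖ := by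
  rw [dist_barlowPos_eq_norm_layerVec, sub_sub_sub_cancel_right, add_sub_add_left_eq_sub]

/-! ### The three-body site energy -/

/-- One term of the three-body site energy: the ordered pair of sites indexed by
`pq = ((k₁, i₁, j₁), (k₂, i₂, j₂))` (layer offsets `kᵢ` from the central layer `m`, in-layer
coordinates `iᵢ, jᵢ`) contributes `Ψ(|x − y|, |x − z|, |y − z|)`, the central site `x` itself and
the diagonal `y = z` being excluded. [folklore] -/
def threeBodyTerm (Ψ : ℝ → ℝ → ℝ → ℝ) (a h : ℝ) (s : ℤ → ℤ) (m : ℤ)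
    (pq : (ℤ × ℤ × ℤ) × (ℤ × ℤ × ℤ)) : ℝ :=
  if pq.1 = 0 ∨ pq.2 = 0 ∨ pq.1 = pq.2 then 0 else
    Ψ (dist (barlowPos a h s m 0 0) (barlowPos a h s (m + pq.1.1) pq.1.2.1 pq.1.2.2))
      (dist (barlowPos a h s m 0 0) (barlowPos a h s (m + pq.2.1) pq.2.2.1 pq.2.2.2))
      (dist (barlowPos a h s (m + pq.1.1) pq.1.2.1 pq.1.2.2)
        (barlowPos a h s (m + pq.2.1) pq.2.2.1 pq.2.2.2))

/-- **The three-body energy of a site** of layer `m` of the Barlow stacking coded by `s`, for a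
three-body potential given (by rotation and translation invariance, Flatley–Theil 2015, (potrep))
as a function `Ψ(r₁, r₂, r₃)` of the three pairwise distances: the sum over ordered pairs
`(y, z)` of sites, `y ≠ z`, both `≠ x`, of `Ψ(|x − y|, |x − z|, |y − z|)` — Flatley–Theil's
`e₃(x) = 2 ∑_{{x₁,x₂}} V₃(y(x), y(x₁), y(x₂))` for a symmetric `Ψ` (a `tsum`; for `Ψ` of bounded
support finitely many terms are non-zero). [cite: FlatleyTheil2015, §2 (potrep) and §6 (e₃)] -/
def barlowSiteEnergy₃ (Ψ : ℝ → ℝ → ℝ → ℝ) (a h : ℝ) (s : ℤ → ℤ) (m : ℤ) : ℝ :=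
  ∑' pq : (ℤ × ℤ × ℤ) × (ℤ × ℤ × ℤ), threeBodyTerm Ψ a h s m pq

/-- `|k| ≥ 2` in `ℝ` for an integer `k ≤ -2` or `k ≥ 2`. [folklore] -/
theorem two_le_abs_cast {k : ℤ} (hk : k ≤ -2 ∨ 2 ≤ k) : (2 : ℝ) ≤ |(k : ℝ)| := by
  rcases hk with hk | hk
  · have : (k : ℝ) ≤ -2 := by exact_mod_cast hk
    rw [abs_of_neg (by linarith)]
    linarith
  · have : (2 : ℝ) ≤ k := by exact_mod_cast hk
    rw [abs_of_nonneg (by linarith)]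
    exact this

variable {Ψ : ℝ → ℝ → ℝ → ℝ}

/-- Pairs with a site two or more layers away from the centre do not contribute (that site is at
distance `≥ 2h`). [folklore] -/
theorem threeBodyTerm_eq_zero_of_far (hh : 0 ≤ h)
    (hΨ : ∀ r₁ r₂ r₃, 2 * h ≤ max r₁ (max r₂ r₃) → Ψ r₁ r₂ r₃ = 0) (t : ℤ → ℤ) (n : ℤ)
    {p q : ℤ × ℤ × ℤ} (hfar : (p.1 ≤ -2 ∨ 2 ≤ p.1) ∨ (q.1 ≤ -2 ∨ 2 ≤ q.1)) :
    threeBodyTerm Ψ a h t n (p, q) = 0 := by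
  unfold threeBodyTerm
  split_ifs with hex
  · rfl
  apply hΨ
  rcases hfar with hp | hq
  · refine le_trans ?_ (le_max_left _ _)
    rw [dist_site_eq_norm_layerVec]
    calc 2 * h ≤ |(p.1 : ℝ)| * h := mul_le_mul_of_nonneg_right (two_le_abs_cast hp) hh
      _ ≤ _ := abs_mul_le_norm_layerVec hh _ _ _ _
  · refine le_trans ?_ (le_max_of_le_right (le_max_left _ _))
    rw [dist_site_eq_norm_layerVec]
    calc 2 * h ≤ |(q.1 : ℝ)| * h := mul_le_mul_of_nonneg_right (two_le_abs_cast hq) hh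
      _ ≤ _ := abs_mul_le_norm_layerVec hh _ _ _ _

/-- Pairs of sites two or more layers apart do not contribute (they are at distance `≥ 2h`).
[folklore] -/
theorem threeBodyTerm_eq_zero_of_apart (hh : 0 ≤ h)
    (hΨ : ∀ r₁ r₂ r₃, 2 * h ≤ max r₁ (max r₂ r₃) → Ψ r₁ r₂ r₃ = 0) (t : ℤ → ℤ) (n : ℤ)
    {p q : ℤ × ℤ × ℤ} (hapart : q.1 - p.1 ≤ -2 ∨ 2 ≤ q.1 - p.1) :
    threeBodyTerm Ψ a h t n (p, q) = 0 := by
  unfold threeBodyTerm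
  split_ifs with hex
  · rfl
  apply hΨ
  refine le_trans ?_ (le_max_of_le_right (le_max_right _ _))
  rw [dist_sites_eq_norm_layerVec]
  calc 2 * h ≤ |((q.1 - p.1 : ℤ) : ℝ)| * h := mul_le_mul_of_nonneg_right (two_le_abs_cast hapart) hh
    _ ≤ _ := abs_mul_le_norm_layerVec hh _ _ _ _

/-- **Congruent clusters give equal terms.** If the letter offsets of the layers `k₁, k₂` seen
from `(t', n')` are `ε` times those seen from `(t, n)`, `ε = ±1`, then the pair of sites with
reflected indices contributes the same term. [folklore] -/
theorem threeBodyTerm_congr {t t' : ℤ → ℤ} {n n' ε : ℤ} (hε : ε = 1 ∨ ε = -1)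
    {p q : ℤ × ℤ × ℤ}
    (h₁ : haggLabel t' (n' + p.1) - haggLabel t' n' = ε * (haggLabel t (n + p.1) - haggLabel t n))
    (h₂ : haggLabel t' (n' + q.1) - haggLabel t' n' = ε * (haggLabel t (n + q.1) - haggLabel t n)) :
    threeBodyTerm Ψ a h t' n' (scaleIdx ε p, scaleIdx ε q) = threeBodyTerm Ψ a h t n (p, q) := by
  have hP : (scaleIdx ε p = 0 ∨ scaleIdx ε q = 0 ∨ scaleIdx ε p = scaleIdx ε q) ↔
      (p = 0 ∨ q = 0 ∨ p = q) := by
    rw [scaleIdx_eq_zero_iff hε, scaleIdx_eq_zero_iff hε, scaleIdx_inj hε]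
  unfold threeBodyTerm
  by_cases hp : p = 0 ∨ q = 0 ∨ p = q
  · rw [if_pos (hP.2 hp), if_pos hp]
  · rw [if_neg (mt hP.1 hp), if_neg hp]
    obtain ⟨k₁, i₁, j₁⟩ := p
    obtain ⟨k₂, i₂, j₂⟩ := q
    simp only [scaleIdx] at h₁ h₂ ⊢
    rw [dist_site_eq_norm_layerVec, dist_site_eq_norm_layerVec, dist_site_eq_norm_layerVec,
      dist_site_eq_norm_layerVec, dist_sites_eq_norm_layerVec, dist_sites_eq_norm_layerVec,
      h₁, h₂, ← mul_sub, ← mul_sub, ← mul_sub, norm_layerVec_scale hε, norm_layerVec_scale hε,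
      norm_layerVec_scale hε]

/-- Letter offsets of the layers `n + k`, `k ∈ {−1, 0, 1}`: `−t(n−1)`, `0`, `t n`. [folklore] -/
theorem haggLabel_offset_one (t : ℤ → ℤ) (n : ℤ) :
    haggLabel t (n + 1) - haggLabel t n = t n := by
  rw [haggLabel_succ]; ring

/-- The layer below is offset by `−t(n−1)` letters. [folklore] -/
theorem haggLabel_offset_neg_one (t : ℤ → ℤ) (n : ℤ) :
    haggLabel t (n + -1) - haggLabel t n = -t (n - 1) := by
  have := haggLabel_sub_haggLabel_pred t n
  rw [← sub_eq_add_neg]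
  linarith

/-- The own layer is not offset. [folklore] -/
theorem haggLabel_offset_zero (t : ℤ → ℤ) (n : ℤ) :
    haggLabel t (n + 0) - haggLabel t n = 0 := by
  simp

/-- The offset relation realised by `pairSign`. [folklore] -/
theorem offset_rel {s s' : ℤ → ℤ} (hs : IsHaggSeq s) (m m' : ℤ)
    {k k₂ : ℤ} (hk : k = -1 ∨ k = 0 ∨ k = 1) (hopp : ¬ (k = -1 ∧ k₂ = 1)) :
    haggLabel s' (m' + k) - haggLabel s' m' =
      pairSign (s' m' * s m) (s' (m' - 1) * s (m - 1)) k k₂ * (haggLabel s (m + k) - haggLabel s m) := by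
  have hsq : s m * s m = 1 := by rcases hs m with h1 | h1 <;> rw [h1] <;> norm_num
  have hsq' : s (m - 1) * s (m - 1) = 1 := by
    rcases hs (m - 1) with h1 | h1 <;> rw [h1] <;> norm_num
  rcases hk with rfl | rfl | rfl
  · rw [haggLabel_offset_neg_one, haggLabel_offset_neg_one]
    unfold pairSign
    rw [if_neg (by omega), if_pos (Or.inl rfl)]
    linear_combination (s' (m' - 1)) * hsq'
  · rw [haggLabel_offset_zero, haggLabel_offset_zero, mul_zero]
  · rw [haggLabel_offset_one, haggLabel_offset_one]
    unfold pairSign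
    rw [if_pos (Or.inl rfl)]
    linear_combination (-(s' m')) * hsq

/-- **Termwise invariance**: the reindexed term of `(s', m')` equals the term of `(s, m)`.
[folklore] -/
theorem threeBodyTerm_pairFlip (hh : 0 ≤ h)
    (hΨ : ∀ r₁ r₂ r₃, 2 * h ≤ max r₁ (max r₂ r₃) → Ψ r₁ r₂ r₃ = 0)
    {s s' : ℤ → ℤ} (hs : IsHaggSeq s) (hs' : IsHaggSeq s') (m m' : ℤ)
    (pq : (ℤ × ℤ × ℤ) × (ℤ × ℤ × ℤ)) :
    threeBodyTerm Ψ a h s' m' (pairFlip (s' m' * s m) (s' (m' - 1) * s (m - 1)) pq) =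
      threeBodyTerm Ψ a h s m pq := by
  obtain ⟨p, q⟩ := pq
  have hU : s' m' * s m = 1 ∨ s' m' * s m = -1 := by
    rcases hs m with h1 | h1 <;> rcases hs' m' with h2 | h2 <;> simp [h1, h2]
  have hD : s' (m' - 1) * s (m - 1) = 1 ∨ s' (m' - 1) * s (m - 1) = -1 := by
    rcases hs (m - 1) with h1 | h1 <;> rcases hs' (m' - 1) with h2 | h2 <;> simp [h1, h2]
  have hε := pairSign_mem hU hD p.1 q.1
  simp only [pairFlip]
  by_cases hfar : (p.1 ≤ -2 ∨ 2 ≤ p.1) ∨ (q.1 ≤ -2 ∨ 2 ≤ q.1)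
  · rw [threeBodyTerm_eq_zero_of_far hh hΨ s m hfar,
      threeBodyTerm_eq_zero_of_far hh hΨ s' m' (by exact hfar)]
  by_cases hapart : q.1 - p.1 ≤ -2 ∨ 2 ≤ q.1 - p.1
  · rw [threeBodyTerm_eq_zero_of_apart hh hΨ s m hapart,
      threeBodyTerm_eq_zero_of_apart hh hΨ s' m' (by exact hapart)]
  have hk₁ : p.1 = -1 ∨ p.1 = 0 ∨ p.1 = 1 := by omega
  have hk₂ : q.1 = -1 ∨ q.1 = 0 ∨ q.1 = 1 := by omega
  refine threeBodyTerm_congr hε ?_ ?_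
  · exact offset_rel hs m m' hk₁ (by omega)
  · rw [pairSign_comm]
    exact offset_rel hs m m' hk₂ (by omega)

/-- **Diameter-localised three-body terms are stacking-blind.** If `Ψ(r₁, r₂, r₃) = 0` as soon as
one of the three pairwise distances is `≥ 2h` (every interacting triple has diameter `< 2h`;
Flatley–Theil's `Ψ = 0` for `max rᵢ ≥ 7/5 < √(8/3)` is an instance at the ideal spacing), then the
three-body site energy is the same for every site of every Barlow stacking: the interacting
triples through a site of layer `m` lie in the two-layer slabs `{m, m+1}` or `{m−1, m}`, and such
slabs of any two stackings are congruent by a horizontal point reflection through the site.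
[folklore] -/
theorem barlowSiteEnergy₃_eq (hh : 0 ≤ h)
    (hΨ : ∀ r₁ r₂ r₃, 2 * h ≤ max r₁ (max r₂ r₃) → Ψ r₁ r₂ r₃ = 0)
    {s s' : ℤ → ℤ} (hs : IsHaggSeq s) (hs' : IsHaggSeq s') (m m' : ℤ) :
    barlowSiteEnergy₃ Ψ a h s m = barlowSiteEnergy₃ Ψ a h s' m' := by
  have hU : s' m' * s m = 1 ∨ s' m' * s m = -1 := by
    rcases hs m with h1 | h1 <;> rcases hs' m' with h2 | h2 <;> simp [h1, h2]
  have hD : s' (m' - 1) * s (m - 1) = 1 ∨ s' (m' - 1) * s (m - 1) = -1 := by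
    rcases hs (m - 1) with h1 | h1 <;> rcases hs' (m' - 1) with h2 | h2 <;> simp [h1, h2]
  unfold barlowSiteEnergy₃
  rw [← Equiv.tsum_eq (pairFlipPerm hU hD) (threeBodyTerm Ψ a h s' m')]
  exact tsum_congr fun pq => (threeBodyTerm_pairFlip hh hΨ hs hs' m m' pq).symm


end ThreeBody


/-! ## Audit 2026-08-15 (D-0021 barrier audit): the narrowed barrier

The blind class is "pair + diameter-localised clusters", not "finite range": conjuncts (1)–(2)
below are the blind side (pair potentials vanishing on `[2h, ∞)`; three-body potentials vanishing on
triples of diameter `≥ 2h`, which contains Flatley–Theil's `Ψ`), conjunct (3) the sighted side (a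
three-body term with two nearest-neighbour legs and free opening reads the letter of the layer). -/

section Narrow

open Literature.MathematicalPhysics.StatisticalMechanics

/-- **Barrier `ShortRangeStackingBlindnessNarrow` (audit 2026-08-15, D-0021: the NARROWED form of
`ShortRangeStackingBlindness`, which is its conjunct (1) — `ShortRangeStackingBlindness_of_narrow`).**
(1) For every pair potential `V` vanishing on `[2h, ∞)` (`0 ≤ h`) the site energy
`barlowSiteEnergy V a h s m` is the same constant for every Hägg sequence `s` and layer `m`
(the catalogued statement). (2) For every three-body potential `Ψ(r₁, r₂, r₃)` of the three
pairwise distances that vanishes as soon as `max rᵢ ≥ 2h` (every interacting triple has diameter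
`< 2h`; at the ideal spacing `2h = √(8/3) ≈ 1.633`, so Flatley–Theil's class "`Ψ(r₁, r₂, r₃) = 0`
if `maxᵢ rᵢ ≥ 7/5`" is inside) the three-body site energy `barlowSiteEnergy₃ Ψ a h s m` is the same
for all Hägg sequences `s, s'` and layers `m, m'` (`0 ≤ h`, any `a`). (3) But at the ideal packing
(`0 < a`, `h² = ⅔a²`) the number of nearest neighbours `w` of the site `x = barlowPos k i j` whose
antipode `2x − w` is again a site — the site energy of the three-body term
`W(x; y, z) = 𝟙[|y − x| = a]·𝟙[y + z = 2x]`, two legs of nearest-neighbour length and opening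
`|y − z| = 2a` left free — equals `12` if `s k = s (k − 1)` (a `c`-layer: `…ABC…` around it) and `6`
otherwise (an `h`-layer: `…ABA…`); so it is `12` at every site of fcc and `6` at every site of hcp
(`fcc_straightBonds`, `hcp_straightBonds`), and in general it reads the Jagodzinski/Hägg letter of
the layer. The dividing line is therefore not the RANGE `√(8/3)` but the SHAPE of the locality:
distance-only and diameter-localised functionals are blind, star-localised (bond-angle) ones are
not. All three conjuncts are proved (`ShortRangeStackingBlindnessNarrow_holds`).

BARRIER (D-0021; every clause is a citation, not an assessment)
* technique_class: finite-range PAIR potentials and DIAMETER-localised cluster potentials — local energies that see the configuration around a site `x` only through (i) the distances `|x − y| < 2h` (pair truncation below the third shell `√(8/3)`; radial shells, coordination numbers, glue/embedded-atom densities `∑_y φ(|x − y|)`) or (ii) the clusters `{x, y, z}` all of whose pairwise distances are `< 2h` (Flatley–Theil: "`V₃(y₁,y₂,y₃) = Ψ(|y₂−y₁|, |y₃−y₂|, |y₁−y₃|)`", "`Ψ(r₁, r₂, r₃) = 0` if `maxᵢ rᵢ ≥ 7/5`" [cite: FlatleyTheil2015, §2 (potrep) and Definition 2.1 (2)]); NOT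 star-localised (bond-angle) many-body terms — legs `|y − x|, |z − x|` short, opening `|y − z|` free — such as "a generalized form of the Stillinger-Weber potential" in the usual leg-cut-off sense, the centrosymmetry parameter, common-neighbour and bond-angle signatures [cite: Stukowski2012, §2.3–§2.6]
* blocks: deciding the stacking — fcc `…ABCABC…`, hcp `…ABAB…` or another Barlow polytype — of the periodic minimiser `P` of `Literature.MathematicalPhysics.StatisticalMechanics.HasPeriodicGroundStateEnergy lennardJones 3`, or of the limit configuration in `Literature.MathematicalPhysics.StatisticalMechanics.IsCrystallizing lennardJones 3`, by truncating the PAIR energy below `√(8/3)` or by any lower bound `E ≥ ∑_x e_loc(x)` with a local energy `e_loc` of type (i) or (ii): every Barlow stacking is then a simultaneous minimiser (conjuncts (1)–(2)); "To differentiate between the fcc and the hcp lattice it is unavoidable to consider medium-range interactions whose range reaches beyond nearest neighbors. Specifically, we require an analysis of second and third nearest neighbor interactions" [cite: FlatleyTheil2015, §1 (arXiv p. 4)] — printed for the `(V, Ψ)` class of Definition 2.1, whose `Ψ` is of type (ii)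
* because: (1)–(2): through a potential of type (i) or (ii) a site of layer `m` interacts only with sites of the layers `m − 1, m, m + 1`, and never with one of `m − 1` and one of `m + 1` in the same cluster (vertical separation `2h`); the two-layer slabs `{m, m+1}`, `{m−1, m}` of any two stackings are congruent by a horizontal point reflection through the site (this file, `barlowSiteEnergy₃_eq`, `ShortRangeStackingBlindness_holds`); radially fcc and hcp agree on the shells `1` (twelve) and `√2` (six) and first differ at `√(8/3)` [cite: ConwaySloane1999, Ch. 4 §6.3 (66) Table 4.5 and §6.5 (73) Table 4.6] [cite: FlatleyTheil2015, §2.1]; (3): the three-layer neighbourhood `{m−1, m, m+1}` is NOT stacking-independent — `x`, an upper neighbour `y` and a lower neighbour `z` are collinear (`y + z = 2x`) for three pairs on a `c`-layer and for none on an `h`-layer, so the straight-bond count is `12` resp. `6` (this file, `ncard_straightBonds`); the letter is local by definition — "h for layers with identical neighbours (ABA), f for those with different (ABC)" [cite: LoachAckland2017, p. 1] — and first-shell three-point data separate fcc from hcp throughout the structure-identification literature: the centrosymmetry parameter `∑_{i=1}^{N/2} |r_i + r_{i+N/2}|²` over "pairs of opposite neighbors", `N = 12`, which "can only be applied to the class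 of centrosymmetric lattices (which does not include hcp, for example)", the bond-order parameters of the twelve neighbour bonds, `Q₄^fcc = 0.191` vs `Q₄^hcp = 0.097`, common-neighbour signatures "computed from the topology of bonds that connect the surrounding neighbor atoms" with cut-off "halfway between the first and second neighbor shell", and bond-angle histograms of `cos θ_ijk` [cite: Stukowski2012, §2.3, §2.4, §2.5, §2.6]; Flatley–Theil themselves single out the cuboctahedron among the two twelve-point shells with `24` contacts by a first-shell pair count with opening `√3`: "There are exactly 48 pairs `z₁, z₂` such that `|z₁ − z₂| = √3` and `|z_i − z| = 1`" — "Property 4 then selects the cuboctahedron" [cite: FlatleyTheil2015, Proposition 3.1 and Theorem 3.5]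
* evasions_known: (i) star-localised selection at nearest-neighbour leg length — conjunct (3) and the signatures above [cite: Stukowski2012, §2.3–§2.6]; in print the selection is done instead by the PAIR condition `V(√(8/3)) − 3V(√3) ≥ α^{1/2}` on the second and third shells together with a diameter-localised `Ψ` and the long-range tail [cite: FlatleyTheil2015, Definition 2.1 and Theorem 1.1] — in `d = 2` star-localised three-body terms do select the lattice (`𝓔₃` "favors triples of particles forming angles which are multiples of `π/2` or `2π/3`": square resp. hexagonal lattice, Mainini–Piovano–Stefanelli, Mainini–Stefanelli), while in `d = 3` the thermodynamic-limit results in print are "some few available rigorous results [Flatley–Theil] in three dimensions" and finite crystallization in three dimensions is listed as a prospect [cite: FriedrichKreutz2023, §1] (search note, zbMATH "crystallization three-body", "crystallization face-centered cubic", "crystallization three dimensions ground state": no fcc/hcp theorem for a finite-range `(V₂, V₃)`); (ii) keep the pair tail and decide fcc/hcp by lattice sums beyond the second shell [cite: BeterminSamajTravenec2022, §1.1 and §3.1]; (iii) leave zero temperature: for hard spheres "all configurations are degenerate in energy", yet the fcc stacking has the highest ENTROPY of all stackings, fcc − hcp `= 0.00115 ± 0.00004 k_B` per sphere at close packing, the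 leading term of `S = A n s₀ + A h ∑σ_i + A J ∑σ_iσ_{i+1} + ⋯` being a field on the local three-layer pattern `σ_i = ±1` (ABC / ABA), "the entropy of a sphere is mostly determined by how it is caged by its nearest neighbors" [cite: MauHuse1999, Abstract and §II] — a contact-range model whose stacking degeneracy is lifted without long-range interactions, outside `HasPeriodicGroundStateEnergy` (`T = 0`)
* scope_caveats: (a) conjunct (1) holds for all `a` and `h ≥ 0`, (2) for `h ≥ 0` and any `a`, (3) at the ideal ratio `h² = ⅔a²` only (exact antipodes; it is the count that matters, a smooth bond-angle term separates `c` from `h` layers for every `a, h > 0`, not formalised); (b) four-body and higher diameter-localised terms are blind by the same slab argument (per-site counts of 4-clusters of diameter `< √(8/3)`: `8, 48, 12` by edge type for fcc, hcp and dhcp sites alike — this audit's enumeration, not formalised); (c) for the summit's conjunct (Lennard-Jones: a PAIR potential, infinite range) the obstruction to truncation below `√(8/3)` stands unchanged — what the narrowing opens is the admissible form of LOCAL ENERGIES in a localisation proof (`e_loc(x)` may depend on the star of `x`, e.g. by charging the stacking-selecting shells `√(8/3)`, `√3` to apex bond angles), and the finite-range `(V₂, V₃)` fcc problem; (d) perfect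 stackings only: nothing here about defects, surfaces (finite `N`) or non-close-packed competitors; (e) radial data at `x` read the letters of the layers `k ± 1` (an `h`-neighbour puts a site at distance `2h` above or below `x`), bond angles at `x` read the letter of layer `k` itself — in dhcp `⟨hc⟩` the `h`-sites have the fcc radial shells up to distance `2` and the hcp bond angles, the `c`-sites the reverse (this audit's enumeration)
* status: theorem (conjuncts (1)–(3) proved in this file)

[cite: FlatleyTheil2015, §1 (arXiv p. 4), Definition 2.1, Proposition 3.1] [cite: Stukowski2012, §2.3–§2.6] [cite: MauHuse1999, Abstract and §II] -/
def ShortRangeStackingBlindnessNarrow : Prop :=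
  ShortRangeStackingBlindness ∧
  (∀ (Ψ : ℝ → ℝ → ℝ → ℝ) (a h : ℝ), 0 ≤ h →
      (∀ r₁ r₂ r₃, 2 * h ≤ max r₁ (max r₂ r₃) → Ψ r₁ r₂ r₃ = 0) →
      ∀ s s' : ℤ → ℤ, IsHaggSeq s → IsHaggSeq s' → ∀ m m' : ℤ,
        barlowSiteEnergy₃ Ψ a h s m = barlowSiteEnergy₃ Ψ a h s' m') ∧
  (∀ (a h : ℝ), 0 < a → h ^ 2 = 2 / 3 * a ^ 2 → ∀ s : ℤ → ℤ, IsHaggSeq s → ∀ k i j : ℤ,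
      {w | w ∈ barlowStacking a h s ∧ dist (barlowPos a h s k i j) w = a ∧
          (2 : ℝ) • barlowPos a h s k i j - w ∈ barlowStacking a h s}.ncard =
        if s k = s (k - 1) then 12 else 6)

/-- **Proof of the narrowed barrier**: conjunct (1) is `ShortRangeStackingBlindness_holds`, (2) is
`barlowSiteEnergy₃_eq`, (3) is `ncard_straightBonds`. [folklore] -/
theorem ShortRangeStackingBlindnessNarrow_holds : ShortRangeStackingBlindnessNarrow :=
  ⟨ShortRangeStackingBlindness_holds,
    fun _ _ _ hh hΨ _ _ hs hs' m m' => barlowSiteEnergy₃_eq hh hΨ hs hs' m m',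
    fun _ _ ha hh _ hs k i j => ncard_straightBonds hs ha hh k i j⟩

/-- The narrowed barrier contains the catalogued one as its first conjunct. [folklore] -/
theorem ShortRangeStackingBlindness_of_narrow (H : ShortRangeStackingBlindnessNarrow) :
    ShortRangeStackingBlindness :=
  H.1

/-- **fcc: twelve straight bonds at every site** (every layer of `…ABCABC…` is a `c`-layer; the
cuboctahedral shell is centrosymmetric). [cite: Stukowski2012, §2.3] -/
theorem fcc_straightBonds (k i j : ℤ) :
    {w | w ∈ fccStacking 1 (√(2 / 3)) ∧ dist (barlowPos 1 (√(2 / 3)) constHagg k i j) w = 1 ∧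
        (2 : ℝ) • barlowPos 1 (√(2 / 3)) constHagg k i j - w ∈ fccStacking 1 (√(2 / 3))}.ncard =
      12 := by
  rw [fccStacking, ncard_straightBonds isHaggSeq_const one_pos
      (by rw [Real.sq_sqrt (by norm_num)]; ring) k i j, if_pos (by simp [constHagg])]

/-- **hcp: six straight bonds at every site** (every layer of `…ABAB…` is an `h`-layer; the twisted
cuboctahedral shell is not centrosymmetric: "centrosymmetric lattices (which does not include
hcp)"). [cite: Stukowski2012, §2.3] -/
theorem hcp_straightBonds (k i j : ℤ) :
    {w | w ∈ hcpStacking 1 (√(2 / 3)) ∧ dist (barlowPos 1 (√(2 / 3)) alternatingHagg k i j) w = 1 ∧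
        (2 : ℝ) • barlowPos 1 (√(2 / 3)) alternatingHagg k i j - w ∈ hcpStacking 1 (√(2 / 3))}.ncard =
      6 := by
  have hne : alternatingHagg k ≠ alternatingHagg (k - 1) := by
    unfold alternatingHagg
    by_cases hk : Even k
    · have hk' : ¬ Even (k - 1) := by rw [Int.even_sub_one]; exact not_not.2 hk
      simp [hk, hk']
    · have hk' : Even (k - 1) := by rw [Int.even_sub_one]; exact hk
      simp [hk, hk']
  rw [hcpStacking, ncard_straightBonds isHaggSeq_alternating one_pos
      (by rw [Real.sq_sqrt (by norm_num)]; ring) k i j, if_neg hne]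

end Narrow


end Literature.Barriers.AtomisticToContinuum

end
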